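import Summits.ABC.ABC.Theorems.TowerFourSubLiouville.Negative.LangWaldschmidtFloor
import Literature.NumberTheory.DiophantineGeometry.BrightAbcTriples

/-!
# `TowerFourSubLiouville` (stmt-ABC-1649): `ABC ⟹` the Lang–Waldschmidt₄ hypothesis `hLW` — the S⁺5 edge is
sandwiched, and its dial is pinned at `κ = 1`

Negative-side module of the standing disprover (cycle 13, refuter-cdisprove-stmt-ABC-1649-g13-0, 2026-08-17), companion of
`IneffectiveSubspaceTowerFourSubLiouvilleOfLangWaldschmidt` (p111401: the edge `stub_cruxOfLangWaldschmidt`, `hLW ⟹ crux`) and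
`Negative.LangWaldschmidtFloor` (p141178: `LW₄(κ)` FALSE for every `κ < 1`).

`hLW` is the product form of the Lang–Waldschmidt conjecture for four logarithms of positive integers with coefficients
`|bᵢ| ≤ 4`: `∀ ε > 0 ∃ C > 0 ∀ a b …, Λ := ∑ bᵢ log aᵢ ≠ 0 ⟹ C (∏ aᵢ)^{−(1+ε)} ≤ |Λ|`; `LW₄(κ)` is the matrix with `−κ`.
After cycle 12 the S⁺5 row of the dial table read "false `κ < 1` / CONJECTURED `κ > 1` (Lang–Waldschmidt) / crux needs any
`κ < 2`", the only typed strengthening on this crux whose ceiling was a classical conjecture rather than an `ABC ⟹` edge.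
This file supplies the edge (folklore in substance — abc controls linear forms in logarithms of integers with bounded
coefficients, cf. Baker 1998, Philippon 1999 — but here it is the tree's own `hLW`, matrix verbatim):

* `hLW_of_abc`: **`ABC ⟹ hLW`**; `langWaldschmidt4_of_abc`: `ABC ⟹ LW₄(κ)` for every `κ > 1`.
  Proof.  `Λ = log P − log Q` for `P = ∏ aᵢ^{bᵢ⁺}`, `Q = ∏ aᵢ^{bᵢ⁻}` (`lw_sum_eq_log_sub_log`), both `≤ A⁴`, `A := ∏ aᵢ`
  (`prod_pow_le_prod_pow_four`), with `rad(PQ) ∣ A` (`radical_posPart_negPart_dvd`).  Divide `{P, Q} = {m < M}` by `g = gcd`: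
  `m' + r = M'` is an abc triple with `rad(m' r M') ≤ A·r` and `|Λ| = log(M'/m') ≥ r/M'` (`lw_core`).  If
  `|Λ| < C A^{−(1+ε)}` then `r < C A^{−(1+ε)} M'`, and abc at `δ = ε/8` gives `M' < K (A r)^{1+δ} < K C^{1+δ} A^{4δ − ε(1+δ)} M' ≤ M'`
  for `C = min(1, 1/K)` (`lw_abc_numerics`) — contradiction.
* `langWaldschmidt4_iff_of_abc`: **under `ABC`, `LW₄(κ) ⟺ 1 < κ` for every `κ ≠ 1`** — the S⁺5 dial is PINNED at `1`
  (floor p141178 + this file), exactly like `UniformLjunggren` at `K = 1`, `HallLang1728` at `κ = 2` (p132424/p131908),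
  `TridentHallLang` at `5/4` (p133548), `PolySzpiro` at `6` (p140986/p141951) and the `φ = 0` axis of the two-exponent
  diagram at `θ = 2` (`Negative.TwoExponentSandwichSharp`).  Left open only: `LW₄(1)` with a fixed constant.

Consequence for the route: the Lang–Waldschmidt edge is sandwiched `ABC ⟹ hLW ⟹ crux` (compose `hLW_of_abc` with
`stub_cruxOfLangWaldschmidt`), so — like S⁺1 (`HallLang1728`), S⁺2/S⁺3 (moving-target ladder), S⁺6 (`UniformSadicTowerFour`) —
S⁺5 is not refutable short of `¬ABC`, and EVERY typed statement on this crux now sits between a landed unconditional floor and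
a landed `ABC ⟹` ceiling.  No definitions are introduced (matrices spelled out).
-/

-- `Summit.ABC.ABC` is the mandated summit-side namespace (CONVENTIONS §2); the duplicate is deliberate.
set_option linter.dupNamespace false

namespace Summit.ABC.ABC.Theorems.TowerFourSubLiouville.Negative

open scoped BigOperators
open Literature.NumberTheory.DiophantineGeometry (IsABCTriple rad rad_def int_cast_eq_toNat_sub_toNat_neg)

/-- Real-exponent bookkeeping behind `hLW_of_abc`: the abc bound `M' < K (A r)^{1+δ}` for the reduced triple
`m' + r = M'` is incompatible with a too-small gap `r < C A^{−(1+ε)} M'` once `M' ≤ A⁴`, `δ = ε/8`, `C ≤ min(1, 1/K)`. -/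
theorem lw_abc_numerics {K δ ε C A r M' : ℝ} (hK : 0 < K) (hε : 0 < ε) (hδ : δ = ε / 8) (hC0 : 0 < C)
    (hC1 : C ≤ 1) (hCK : C ≤ K⁻¹) (hA : 1 ≤ A) (hr : 0 ≤ r) (hM' : 1 ≤ M') (hM'A : M' ≤ A ^ (4:ℕ))
    (habc : M' < K * (A * r) ^ (1 + δ)) (hrlt : r < C * A ^ (-(1 + ε)) * M') : False := by
  have hδ0 : 0 < δ := by rw [hδ]; positivity
  have hA0 : 0 < A := by linarith
  have hM'0 : 0 < M' := by linarith
  have hL0 : 0 ≤ C * A ^ (-(1 + ε)) := by positivity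
  -- r^{1+δ} ≤ (C A^{-(1+ε)} M')^{1+δ} = C^{1+δ} A^{-(1+ε)(1+δ)} M' M'^δ
  have h2 : r ^ (1 + δ) ≤ (C * A ^ (-(1 + ε)) * M') ^ (1 + δ) := Real.rpow_le_rpow hr hrlt.le (by linarith)
  have h3 : (C * A ^ (-(1 + ε)) * M') ^ (1 + δ) =
      C ^ (1 + δ) * A ^ (-(1 + ε) * (1 + δ)) * (M' * M' ^ δ) := by
    rw [Real.mul_rpow hL0 hM'0.le, Real.mul_rpow hC0.le (by positivity), ← Real.rpow_mul hA0.le,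
      Real.rpow_add hM'0, Real.rpow_one]
  have h5 : M' ^ δ ≤ A ^ (4 * δ) := by
    calc M' ^ δ ≤ (A ^ (4:ℕ)) ^ δ := Real.rpow_le_rpow hM'0.le hM'A hδ0.le
      _ = A ^ (4 * δ) := by rw [← Real.rpow_natCast, ← Real.rpow_mul hA0.le]; norm_num
  have h6 : C ^ (1 + δ) ≤ C := by
    calc C ^ (1 + δ) ≤ C ^ (1:ℝ) := Real.rpow_le_rpow_of_exponent_ge hC0 hC1 (by linarith)
      _ = C := Real.rpow_one C
  have h7 : A ^ (1 + δ) * A ^ (-(1 + ε) * (1 + δ)) * A ^ (4 * δ) = A ^ (4 * δ - ε * (1 + δ)) := by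
    rw [← Real.rpow_add hA0, ← Real.rpow_add hA0]; congr 1; ring
  have h8 : A ^ (4 * δ - ε * (1 + δ)) ≤ 1 := by
    apply Real.rpow_le_one_of_one_le_of_nonpos hA
    rw [hδ]; nlinarith
  have hKC : K * C ≤ 1 := by
    calc K * C ≤ K * K⁻¹ := mul_le_mul_of_nonneg_left hCK hK.le
      _ = 1 := mul_inv_cancel₀ hK.ne'
  have key : M' < M' := by
    calc M' < K * (A * r) ^ (1 + δ) := habc
      _ = K * (A ^ (1 + δ) * r ^ (1 + δ)) := by rw [Real.mul_rpow hA0.le hr]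
      _ ≤ K * (A ^ (1 + δ) * (C ^ (1 + δ) * A ^ (-(1 + ε) * (1 + δ)) * (M' * M' ^ δ))) := by
          rw [← h3]; gcongr
      _ ≤ K * (A ^ (1 + δ) * (C * A ^ (-(1 + ε) * (1 + δ)) * (M' * A ^ (4 * δ)))) := by gcongr
      _ = (K * C) * (A ^ (1 + δ) * A ^ (-(1 + ε) * (1 + δ)) * A ^ (4 * δ)) * M' := by ring
      _ = (K * C) * A ^ (4 * δ - ε * (1 + δ)) * M' := by rw [h7]
      _ ≤ 1 * 1 * M' := by gcongr
      _ = M' := by ring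
  exact lt_irrefl _ key

/-- `|b| ≤ n ⟹ b⁺, b⁻ ≤ n`. -/
theorem toNat_le_of_abs_le {b : ℤ} {n : ℕ} (h : |b| ≤ (n : ℤ)) : b.toNat ≤ n ∧ (-b).toNat ≤ n := by
  have h' := abs_le.mp h
  constructor <;> (apply Int.toNat_le.mpr; omega)

/-- The linear form in four logarithms is `log P − log Q` for the positive-part and negative-part products
`P = ∏ aᵢ^{bᵢ⁺}`, `Q = ∏ aᵢ^{bᵢ⁻}` (`b = b⁺ − b⁻`: `int_cast_eq_toNat_sub_toNat_neg` of `Literature…BrightAbcTriples`). -/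
theorem lw_sum_eq_log_sub_log (a : Fin 4 → ℕ) (b : Fin 4 → ℤ) (ha : ∀ i, 0 < a i) :
    (∑ i, (b i : ℝ) * Real.log (a i : ℝ)) =
      Real.log (((∏ i, a i ^ (b i).toNat : ℕ) : ℝ)) - Real.log (((∏ i, a i ^ (-b i).toNat : ℕ) : ℝ)) := by
  have hne : ∀ i ∈ (Finset.univ : Finset (Fin 4)), ∀ n : ℕ, ((a i : ℝ)) ^ n ≠ 0 := fun i _ n =>
    pow_ne_zero _ (by exact_mod_cast (ha i).ne')
  push_cast
  rw [Real.log_prod (fun i hi => hne i hi _), Real.log_prod (fun i hi => hne i hi _), ← Finset.sum_sub_distrib]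
  refine Finset.sum_congr rfl fun i _ => ?_
  rw [Real.log_pow, Real.log_pow, int_cast_eq_toNat_sub_toNat_neg (b i)]
  ring

/-- `∏ aᵢ^{eᵢ} ≤ (∏ aᵢ)⁴` for exponents `eᵢ ≤ 4` and `aᵢ ≥ 1`. -/
theorem prod_pow_le_prod_pow_four (a : Fin 4 → ℕ) (e : Fin 4 → ℕ) (ha : ∀ i, 0 < a i) (he : ∀ i, e i ≤ 4) :
    ∏ i, a i ^ e i ≤ (∏ i, a i) ^ 4 := by
  rw [← Finset.prod_pow]
  exact Finset.prod_le_prod' fun i _ => Nat.pow_le_pow_right (ha i) (he i)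

/-- The radical of `P · Q` divides `∏ aᵢ`. -/
theorem radical_posPart_negPart_dvd (a : Fin 4 → ℕ) (b : Fin 4 → ℤ) :
    UniqueFactorizationMonoid.radical ((∏ i, a i ^ (b i).toNat) * (∏ i, a i ^ (-b i).toNat)) ∣ ∏ i, a i := by
  rw [← Finset.prod_mul_distrib]
  calc UniqueFactorizationMonoid.radical (∏ i, (a i ^ (b i).toNat * a i ^ (-b i).toNat))
      ∣ ∏ i, UniqueFactorizationMonoid.radical (a i ^ (b i).toNat * a i ^ (-b i).toNat) :=
        UniqueFactorizationMonoid.radical_prod_dvd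
    _ ∣ ∏ i, a i := Finset.prod_dvd_prod_of_dvd _ _ fun i _ => by
        rw [← pow_add]
        exact UniqueFactorizationMonoid.radical_pow_dvd.trans UniqueFactorizationMonoid.radical_dvd_self

/-- The arithmetic core: for naturals `0 < m < M ≤ A⁴` with `radical(m·M) ∣ A`, the abc bound with constant `K` at
`δ = ε/8` gives `C · A^{−(1+ε)} ≤ log M − log m` with `C = min 1 K⁻¹`. -/
theorem lw_core {K δ ε : ℝ} {A m M : ℕ} (hK : 0 < K) (hε : 0 < ε) (hδ : δ = ε / 8)
    (habcK : ∀ a b c : ℕ, IsABCTriple a b c → (c : ℝ) < K * ((rad a b c : ℕ) : ℝ) ^ (1 + δ))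
    (hm : 0 < m) (hmM : m < M) (hMA : M ≤ A ^ 4) (hA : 0 < A)
    (hrad : UniqueFactorizationMonoid.radical (m * M) ∣ A) :
    min 1 K⁻¹ * ((A : ℕ) : ℝ) ^ (-(1 + ε)) ≤ Real.log (M : ℝ) - Real.log (m : ℝ) := by
  -- reduce by the gcd
  set g : ℕ := Nat.gcd m M with hg
  have hg0 : 0 < g := Nat.gcd_pos_of_pos_left _ hm
  obtain ⟨m', hm'⟩ : g ∣ m := Nat.gcd_dvd_left m M
  obtain ⟨M', hM'⟩ : g ∣ M := Nat.gcd_dvd_right m M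
  have hm'0 : 0 < m' := by
    rcases Nat.eq_zero_or_pos m' with h | h
    · rw [h, mul_zero] at hm'; omega
    · exact h
  have hlt' : m' < M' := by
    by_contra hle
    push Not at hle
    have : M ≤ m := by rw [hm', hM']; exact Nat.mul_le_mul_left g hle
    omega
  have hM'0 : 0 < M' := lt_trans hm'0 hlt'
  have hcop : Nat.Coprime m' M' := by
    have h := Nat.coprime_div_gcd_div_gcd (m := m) (n := M) hg0
    rwa [← hg, hm', hM', Nat.mul_div_cancel_left _ hg0, Nat.mul_div_cancel_left _ hg0] at h
  -- the abc triple m' + r = M'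
  set r : ℕ := M' - m' with hr
  have hr0 : 0 < r := Nat.sub_pos_of_lt hlt'
  have hsum : m' + r = M' := by rw [hr]; omega
  have hcopr : Nat.Coprime m' r := by rw [hr, Nat.coprime_sub_self_right hlt'.le]; exact hcop
  have htriple : IsABCTriple m' r M' := ⟨hm'0, hr0, hsum, hcopr⟩
  have habc := habcK _ _ _ htriple
  -- radical bound: rad(m' r M') ≤ A r
  have hmM0 : m * M ≠ 0 := Nat.mul_ne_zero hm.ne' (by omega)
  have hrad_dvd : rad m' r M' ∣ A * r := by
    rw [rad_def, show m' * r * M' = (m' * M') * r by ring]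
    calc UniqueFactorizationMonoid.radical (m' * M' * r)
        ∣ UniqueFactorizationMonoid.radical (m' * M') * UniqueFactorizationMonoid.radical r :=
          UniqueFactorizationMonoid.radical_mul_dvd
      _ ∣ A * r := by
          refine mul_dvd_mul ?_ UniqueFactorizationMonoid.radical_dvd_self
          refine (UniqueFactorizationMonoid.radical_dvd_radical ?_ hmM0).trans hrad
          exact ⟨g * g, by rw [hm', hM']; ring⟩
  have hradle : ((rad m' r M' : ℕ) : ℝ) ≤ (A : ℝ) * (r : ℝ) := by
    have := Nat.le_of_dvd (Nat.mul_pos hA hr0) hrad_dvd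
    exact_mod_cast this
  -- log M − log m = log M' − log m' ≥ r / M'
  have hgR : (0:ℝ) < (g:ℝ) := by exact_mod_cast hg0
  have hm'R : (0:ℝ) < (m':ℝ) := by exact_mod_cast hm'0
  have hM'R : (0:ℝ) < (M':ℝ) := by exact_mod_cast hM'0
  have hlog : Real.log (M : ℝ) - Real.log (m : ℝ) = Real.log (M' : ℝ) - Real.log (m' : ℝ) := by
    rw [hm', hM']; push_cast
    rw [Real.log_mul hgR.ne' hM'R.ne', Real.log_mul hgR.ne' hm'R.ne']; ring
  have hgap : ((r : ℕ) : ℝ) / (M' : ℝ) ≤ Real.log (M' : ℝ) - Real.log (m' : ℝ) := by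
    have h1 := Real.log_le_sub_one_of_pos (div_pos hm'R hM'R)
    rw [Real.log_div hm'R.ne' hM'R.ne'] at h1
    have hrR : ((r : ℕ) : ℝ) = (M' : ℝ) - (m' : ℝ) := by rw [hr]; exact Nat.cast_sub hlt'.le
    rw [hrR, sub_div, div_self hM'R.ne']
    linarith
  -- suppose the gap is too small and contradict abc
  rw [hlog]
  by_contra hnot
  push Not at hnot
  have hA1 : (1:ℝ) ≤ (A:ℝ) := by exact_mod_cast hA
  have hC0 : (0:ℝ) < min 1 K⁻¹ := lt_min one_pos (inv_pos.mpr hK)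
  have hrlt : (r : ℝ) < min 1 K⁻¹ * (A : ℝ) ^ (-(1 + ε)) * (M' : ℝ) := by
    have h := lt_of_le_of_lt hgap hnot
    rw [div_lt_iff₀ hM'R] at h
    linarith
  have hM'A : (M' : ℝ) ≤ (A : ℝ) ^ (4:ℕ) := by
    have h1 : M' ≤ M := by
      calc M' = 1 * M' := (one_mul _).symm
        _ ≤ g * M' := Nat.mul_le_mul_right _ hg0
        _ = M := hM'.symm
    exact_mod_cast h1.trans hMA
  have habc' : (M' : ℝ) < K * ((A : ℝ) * (r : ℝ)) ^ (1 + δ) := by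
    calc (M' : ℝ) < K * ((rad m' r M' : ℕ) : ℝ) ^ (1 + δ) := habc
      _ ≤ K * ((A : ℝ) * (r : ℝ)) ^ (1 + δ) := by
          have hδ0 : 0 < δ := by rw [hδ]; positivity
          gcongr
  exact lw_abc_numerics hK hε hδ hC0 (min_le_left _ _) (min_le_right _ _) hA1 (by positivity)
    (by exact_mod_cast hM'0) hM'A habc' hrlt

/-- **`ABC ⟹ hLW`.**  The hypothesis of the landed edge `stub_cruxOfLangWaldschmidt` (p111401) — Lang–Waldschmidt for four
logarithms of positive integers with coefficients `|bᵢ| ≤ 4`, exponent `−(1+ε)` for every `ε > 0` — follows from `ABC`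
(matrix verbatim).  Proof: `Λ = ∑ bᵢ log aᵢ = log P − log Q` with `P = ∏ aᵢ^{bᵢ⁺}`, `Q = ∏ aᵢ^{bᵢ⁻} ≤ A⁴`, `A = ∏ aᵢ`;
reduce `{P, Q}` by the gcd to an abc triple `m' + r = M'` with `rad ≤ A·r`; then `|Λ| = log(M'/m') ≥ r/M'` and abc at
`δ = ε/8` forbids `r < C A^{−(1+ε)} M'` for `C = min(1, 1/K(δ))`. -/
theorem hLW_of_abc (habc : ABC) :
    ∀ ε : ℝ, 0 < ε → ∃ C : ℝ, 0 < C ∧ ∀ a : Fin 4 → ℕ, ∀ b : Fin 4 → ℤ, (∀ i, 0 < a i) →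
      (∀ i, |b i| ≤ 4) → (∑ i, (b i : ℝ) * Real.log (a i : ℝ)) ≠ 0 →
      C * (((∏ i, a i : ℕ) : ℝ)) ^ (-(1 + ε)) ≤ |∑ i, (b i : ℝ) * Real.log (a i : ℝ)| := by
  intro ε hε
  obtain ⟨K, hK, hKabc⟩ := (ABC_iff.mp habc) (ε / 8) (by positivity)
  refine ⟨min 1 K⁻¹, lt_min one_pos (inv_pos.mpr hK), fun a b ha hb hΛ => ?_⟩
  set P : ℕ := ∏ i, a i ^ (b i).toNat with hP
  set Q : ℕ := ∏ i, a i ^ (-b i).toNat with hQ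
  set A : ℕ := ∏ i, a i with hA
  have hAp : 0 < A := Finset.prod_pos fun i _ => ha i
  have hPp : 0 < P := Finset.prod_pos fun i _ => pow_pos (ha i) _
  have hQp : 0 < Q := Finset.prod_pos fun i _ => pow_pos (ha i) _
  have hPA : P ≤ A ^ 4 := prod_pow_le_prod_pow_four a _ ha fun i => (toNat_le_of_abs_le (hb i)).1
  have hQA : Q ≤ A ^ 4 := prod_pow_le_prod_pow_four a _ ha fun i => (toNat_le_of_abs_le (hb i)).2
  have hΛeq : (∑ i, (b i : ℝ) * Real.log (a i : ℝ)) = Real.log (P : ℝ) - Real.log (Q : ℝ) :=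
    lw_sum_eq_log_sub_log a b ha
  have hradPQ : UniqueFactorizationMonoid.radical (P * Q) ∣ A := radical_posPart_negPart_dvd a b
  rw [hΛeq] at hΛ ⊢
  have hPQ : P ≠ Q := fun h => hΛ (by rw [h, sub_self])
  rcases lt_or_gt_of_ne hPQ with hlt | hgt
  · -- P < Q : |log P − log Q| = log Q − log P
    have hle : Real.log (P : ℝ) ≤ Real.log (Q : ℝ) :=
      Real.log_le_log (by exact_mod_cast hPp) (by exact_mod_cast hlt.le)
    rw [abs_sub_comm, abs_of_nonneg (sub_nonneg.mpr hle)]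
    exact lw_core hK hε rfl hKabc hPp hlt hQA hAp hradPQ
  · -- Q < P
    have hle : Real.log (Q : ℝ) ≤ Real.log (P : ℝ) :=
      Real.log_le_log (by exact_mod_cast hQp) (by exact_mod_cast hgt.le)
    rw [abs_of_nonneg (sub_nonneg.mpr hle)]
    exact lw_core hK hε rfl hKabc hQp hgt hPA hAp (by rwa [mul_comm] at hradPQ)


/-- **`ABC ⟹ LW₄(κ)` for every `κ > 1`** (the dial form of `Negative.LangWaldschmidtFloor`: exponent `−κ`). -/
theorem langWaldschmidt4_of_abc {κ : ℝ} (habc : ABC) (hκ : 1 < κ) :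
    ∃ C : ℝ, 0 < C ∧ ∀ a : Fin 4 → ℕ, ∀ b : Fin 4 → ℤ, (∀ i, 0 < a i) → (∀ i, |b i| ≤ 4) →
      (∑ i, (b i : ℝ) * Real.log (a i : ℝ)) ≠ 0 →
      C * (((∏ i, a i : ℕ) : ℝ)) ^ (-κ) ≤ |∑ i, (b i : ℝ) * Real.log (a i : ℝ)| := by
  have h := hLW_of_abc habc (κ - 1) (by linarith)
  rwa [show (1 : ℝ) + (κ - 1) = κ by ring] at h

/-- **The S⁺5 dial is PINNED at `κ = 1` under `ABC`**: `LW₄(κ)` is false for `κ < 1` (unconditionally, p141178: the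
Pell–Bezout instances of the edge's own dictionary) and true for `κ > 1` under `ABC` (this file); only `κ = 1` with a
fixed constant is left open (sub-polynomial question, ⟺ enemies of the core with `|wZ⁴ − vY⁴|·(v³w)^{1/4} = o(Z²)`). -/
theorem langWaldschmidt4_iff_of_abc (habc : ABC) {κ : ℝ} (hκ : κ ≠ 1) :
    (∃ C : ℝ, 0 < C ∧ ∀ a : Fin 4 → ℕ, ∀ b : Fin 4 → ℤ, (∀ i, 0 < a i) → (∀ i, |b i| ≤ 4) →
      (∑ i, (b i : ℝ) * Real.log (a i : ℝ)) ≠ 0 →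
      C * (((∏ i, a i : ℕ) : ℝ)) ^ (-κ) ≤ |∑ i, (b i : ℝ) * Real.log (a i : ℝ)|) ↔ 1 < κ := by
  constructor
  · intro h
    by_contra hle
    push Not at hle
    exact not_langWaldschmidt4_of_lt_one (lt_of_le_of_ne hle hκ) h
  · exact langWaldschmidt4_of_abc habc

end Summit.ABC.ABC.Theorems.TowerFourSubLiouville.Negative
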